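import Literature.NumberTheory.Rogawski1990.AdelicStableOrbitalSupportFiniteG2
import Literature.NumberTheory.Rogawski1990.AdelicStableClassesProduct
import HarnessLib

/-!
# `𝒞_𝐀(γ₀) ⊂ ConjClasses U(H₂)(𝐀)` READS as a restricted product × arch for ANY pair of hermitian forms `(H₁, H₂)` — the dictionary
# (img)(ev)(inj)(surj) on ★ `MatchingAdeleG₂ L H₁ H₂ γ₀`, FACT-FREE
(Rogawski (1990), §3.3 p. 21: «`𝒪_st(γ∕𝐀)` … `γ′_v` is conjugate to `γ` by an element of `K_v` for almost all `v`»; §4.3 p. 44; §5.4 pp. 72–73;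
Kottwitz (1986) Prop. 7.1)

Topic `NumberTheory/Rogawski1990`; namespace `Literature.NumberTheory.Rogawski1990`.  THEOREMS ONLY: no definition, no named fact, no instance, no `sorry`.
Cell `pub/hodgecm-mathlib`, ENGINE T1, O11 «T1b assembly», (G2)-kernel step 1: the GENERIC twin of ★ (E2) `AdelicStableClassesProduct` (`H₂ = Φ₃`, carrier ★
`MatchingAdeleG`, [Kt₄] 7.1 entering as the named fact ★ `MatchingAdeleGEventuallyKConj`) and of ★ (E2-G′) `AdelicStableClassesProductGp` (carrier ★ `MatchingAdele`
over an endoscopic `γ_H`).  Here the carrier is ★ F0P3a-p08 `MatchingAdeleG₂ L H₁ H₂ γ₀` (adèles of `U(H₂)` corresponding place by place to a rational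
`γ₀ ∈ U(H₁)(L⁺)`; `H₂ = Φ₃` is ★ `MatchingAdeleG` by ★ `MatchingAdeleG₂.classes_antidiagThree`, `H₂ = H₁` is the SELF carrier `𝒞′_𝐀(γ₀)` of the inner form — the
index set of the `κ = 1` term of (5.4.3) for `J_{G′}`, for EVERY regular `γ₀` including type (3)), and [Kt₄] Prop. 7.1 enters as a THEOREM: two elements of
`K_v = U(H₂)(𝒪_v)` with characteristic polynomial `p_{γ₀} ⊗ 1` are `K_v`-conjugate for almost all `v` (★ F0P3a-p08 `MatchingAdeleG₂.eventually_forall_exists_conj` over ★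
`UnitaryGroup.eventually_forall_integralConj_cmDatum_of_charpoly_eq`, the cofinite set depending on `(H₂, p_{γ₀})` only).  For ★ (E1) `finsum_mem_eq_finsum_mul_prod_finsum_of_factor` with `𝒞 := MatchingAdeleG₂.classes L H₁ H₂ γ₀`,
`π_v := ConjClasses.map (toLocal v)`, `π_∞ := ConjClasses.map archPart`, `St_v := {d | (γ₀)_v ↔ out d}`, `St_∞ := {b | γ₀ ⊗ 1 ↔ out b}`, base classes
`e_v := [γ_v]` of a rational correspondent `γ ∈ U(H₂)(L⁺)` (★ `Corresponds (cmConjRingHom L) H₁ H₂ γ₀ γ`; for the self carrier `γ := γ₀`):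

* §0 the ABSOLUTE a.e. `K_v`-conjugacy at a rational correspondent `γ_v` (`MatchingAdeleG₂.eventually_exists_mem_conj`) from the RELATIVE form ★ F0P3a-p08
  `MatchingAdeleG₂.eventually_forall_exists_conj` (★ `AdelicStableOrbitalSupportFiniteG2`: both elements have characteristic polynomial `p_{γ₀} ⊗ 1`);
* §1 (img) `MatchingAdeleG₂.corresponds_out_map_toLocal`, `MatchingAdeleG₂.corresponds_out_map_archPart`;
* §2 (ev) `MatchingAdeleG₂.eventually_map_toLocal_eq_mk`;
* §3 (inj) `MatchingAdeleG₂.eq_of_forall_map_toLocal_eq_of_map_archPart_eq` (REFERENCE-FREE);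
* §4 (surj) `MatchingAdeleG₂.exists_mem_classes_of_forall`.
HC_CM is proved only modulo the printed citations until rung 0 closes; this file is unconditional.

## References
* [Rogawski1990] J. D. Rogawski, *Automorphic Representations of Unitary Groups in Three Variables*, Ann. of Math. Stud. 123 (1990), §3.3 p. 21, §4.3 p. 44,
  §5.4 pp. 72–73.
* [Kottwitz1986] R. E. Kottwitz, *Stable trace formula: elliptic singular terms*, Math. Ann. 275 (1986), Prop. 7.1, Cor. 7.3.
* [BorelJacquet1979] A. Borel, H. Jacquet, *Automorphic forms and automorphic representations*, PSPM 33.1 (1979), §4.1.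
-/

noncomputable section

open NumberField IsDedekindDomain Filter
open scoped Matrix MatrixGroups

namespace Literature.NumberTheory.Rogawski1990

open Literature.NumberTheory.Automorphic

section DictionaryG2

variable {L : Type} [Field L] [NumberField L] [IsCMField L] {H₁ H₂ : Matrix (Fin 3) (Fin 3) L}
  {γ₀ : (UnitaryGroup.cmDatum L 3 H₁).Rational}

/-! ## §0 [Kt₄] Prop. 7.1 on `U(H₂)`, ABSOLUTE form at a rational correspondent (the relative form is ★ p08 `MatchingAdeleG₂.eventually_forall_exists_conj`) -/

/-- **[Kt₄] Prop. 7.1, ABSOLUTE form at a rational correspondent**: for `γ₀ ↔ γ` (`γ ∈ U(H₂)(L⁺)`), every matching adèle `p` satisfies `k γ_v k⁻¹ = p_v` with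
`k ∈ K_v` for almost all `v` (the relative form + `p_v, γ_v ∈ K_v` a.e., ★ `eventually_toLocal_mem_cmLocalIntegralLevel`). The generic twin of ★
`MatchingAdeleGEventuallyKConj.eventually_forall_exists_conj` ∕ ★ `eventually_exists_mem_conj_matchingAdele`, FACT-FREE.
[cite: Kottwitz1986, Prop. 7.1] [cite: Rogawski1990, §3.3 p. 21; §4.3 p. 44] -/
theorem MatchingAdeleG₂.eventually_exists_mem_conj (hH₂ : (H₂.map (cmConjRingHom L))ᵀ = H₂) (hdet : H₂.det ≠ 0)
    (hreg : IsRegularElt (γ₀.val : GL (Fin 3) L)) {γ : (UnitaryGroup.cmDatum L 3 H₂).Rational}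
    (hγ : Corresponds (cmConjRingHom L) H₁ H₂ γ₀ γ) (p : MatchingAdeleG₂ L H₁ H₂ γ₀) :
    ∀ᶠ v in cofinite, ∃ k ∈ UnitaryGroup.cmLocalIntegralLevel L 3 H₂ v,
      k * (UnitaryGroup.cmDatum L 3 H₂).toLocal v ((UnitaryGroup.cmDatum L 3 H₂).toAdelic γ) * k⁻¹ = (UnitaryGroup.cmDatum L 3 H₂).toLocal v p.adele := by
  filter_upwards [MatchingAdeleG₂.eventually_forall_exists_conj hH₂ hdet hreg,
    eventually_toLocal_mem_cmLocalIntegralLevel ((UnitaryGroup.cmDatum L 3 H₂).toAdelic γ), eventually_toLocal_mem_cmLocalIntegralLevel p.adele]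
    with v hv hγint hpint
  exact hv _ _ hγint hpint (corresponds_toLocal_toAdelic hγ v) (p.corresponds_toLocal v)

/-! ## §1 (img) local and archimedean classes of `𝒞_𝐀(γ₀)` lie in the stable classes -/

/-- **(img, finite places)**: the representative of the local class of `c ∈ 𝒞_𝐀(γ₀)` corresponds to `(γ₀)_v` (★ `MatchingAdeleG₂.corresponds_toLocal`; `↔` is constant
on stable classes, ★ `Corresponds.of_isStablyConj_right`). [cite: Rogawski1990, §3.3 p. 21] -/
theorem MatchingAdeleG₂.corresponds_out_map_toLocal {c : ConjClasses (UnitaryGroup.cmDatum L 3 H₂).Adelic}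
    (hc : c ∈ MatchingAdeleG₂.classes L H₁ H₂ γ₀) (v : HeightOneSpectrum (𝓞 ↥(maximalRealSubfield L))) :
    Corresponds (UnitaryGroup.conjLocal L (IsCMField.complexConj L) v)
      ((UnitaryGroup.adelicForm L 3 H₁).map (UnitaryGroup.adeleToLocal L v)) ((UnitaryGroup.adelicForm L 3 H₂).map (UnitaryGroup.adeleToLocal L v))
      ((UnitaryGroup.cmDatum L 3 H₁).toLocal v ((UnitaryGroup.cmDatum L 3 H₁).toAdelic γ₀))
      (Quotient.out (ConjClasses.map ((UnitaryGroup.cmDatum L 3 H₂).toLocal v) c)) := by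
  obtain ⟨p, rfl⟩ := hc
  exact (p.corresponds_toLocal v).of_isStablyConj_right (isStablyConj_of_isConj (isConj_out_conjClasses_mk _))

/-- **(img, archimedean)**: the representative of the archimedean class of `c ∈ 𝒞_𝐀(γ₀)` corresponds to `γ₀ ⊗ 1` (★ `MatchingAdeleG₂.corresponds_arch`).
[cite: Rogawski1990, §5.4 p. 72] -/
theorem MatchingAdeleG₂.corresponds_out_map_archPart {c : ConjClasses (UnitaryGroup.cmDatum L 3 H₂).Adelic}
    (hc : c ∈ MatchingAdeleG₂.classes L H₁ H₂ γ₀) :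
    Corresponds (UnitaryGroup.conjMixed (↥(maximalRealSubfield L)) L (IsCMField.complexConj L)) (UnitaryGroup.archFormOf L 3 H₁)
      (UnitaryGroup.archFormOf L 3 H₂) (cmRationalToArch L 3 H₁ γ₀)
      (Quotient.out (ConjClasses.map (UnitaryGroup.archPart (↥(maximalRealSubfield L)) L (IsCMField.complexConj L) 3 H₂) c)) := by
  obtain ⟨p, rfl⟩ := hc
  exact p.corresponds_arch.of_isStablyConj_right (isStablyConj_of_isConj (isConj_out_conjClasses_mk _))

/-! ## §2 (ev) the local class is the base class almost everywhere -/

/-- **(ev)**: for `H₂` hermitian non-degenerate, `γ₀` regular with a rational correspondent `γ ∈ U(H₂)(L⁺)`, the local class of any `c ∈ 𝒞_𝐀(γ₀)` is the base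
class `[γ_v]` for all but finitely many `v` (`MatchingAdeleG₂.eventually_exists_mem_conj`). [cite: Rogawski1990, §3.3 p. 21; §4.3 p. 44] [cite: Kottwitz1986, Prop. 7.1] -/
theorem MatchingAdeleG₂.eventually_map_toLocal_eq_mk (hH₂ : (H₂.map (cmConjRingHom L))ᵀ = H₂) (hdet : H₂.det ≠ 0)
    (hreg : IsRegularElt (γ₀.val : GL (Fin 3) L)) {γ : (UnitaryGroup.cmDatum L 3 H₂).Rational}
    (hγ : Corresponds (cmConjRingHom L) H₁ H₂ γ₀ γ)
    {c : ConjClasses (UnitaryGroup.cmDatum L 3 H₂).Adelic} (hc : c ∈ MatchingAdeleG₂.classes L H₁ H₂ γ₀) :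
    ∀ᶠ v in cofinite, ConjClasses.map ((UnitaryGroup.cmDatum L 3 H₂).toLocal v) c =
      ConjClasses.mk ((UnitaryGroup.cmDatum L 3 H₂).toLocal v ((UnitaryGroup.cmDatum L 3 H₂).toAdelic γ)) := by
  obtain ⟨p, rfl⟩ := hc
  filter_upwards [MatchingAdeleG₂.eventually_exists_mem_conj hH₂ hdet hreg hγ p] with v hv
  obtain ⟨k, -, hk⟩ := hv
  rw [conjClasses_map_mk, ConjClasses.mk_eq_mk_iff_isConj]
  exact (isConj_iff.2 ⟨k, hk⟩).symm

/-! ## §3 (inj) a class of `𝒞_𝐀(γ₀)` is determined by its local classes and its archimedean class — reference-free -/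

/-- **(inj) — the gluing, REFERENCE-FREE** (`H₂` hermitian non-degenerate, `γ₀` regular): two classes of `𝒞_𝐀(γ₀) ⊂ ConjClasses U(H₂)(𝐀)` with the same local class at
every finite place and the same archimedean class are EQUAL — integral conjugators a.e. by the relative [Kt₄] 7.1 (`MatchingAdeleG₂.eventually_forall_exists_conj`), glued by
★ `UnitaryGroup.isConj_of_isConj_archPart_of_forall_exists_conj`. [cite: Rogawski1990, §3.3 p. 21] [cite: Kottwitz1986, Prop. 7.1] -/
theorem MatchingAdeleG₂.eq_of_forall_map_toLocal_eq_of_map_archPart_eq (hH₂ : (H₂.map (cmConjRingHom L))ᵀ = H₂) (hdet : H₂.det ≠ 0)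
    (hreg : IsRegularElt (γ₀.val : GL (Fin 3) L))
    {c c' : ConjClasses (UnitaryGroup.cmDatum L 3 H₂).Adelic}
    (hc : c ∈ MatchingAdeleG₂.classes L H₁ H₂ γ₀) (hc' : c' ∈ MatchingAdeleG₂.classes L H₁ H₂ γ₀)
    (hv : ∀ v : HeightOneSpectrum (𝓞 ↥(maximalRealSubfield L)),
      ConjClasses.map ((UnitaryGroup.cmDatum L 3 H₂).toLocal v) c = ConjClasses.map ((UnitaryGroup.cmDatum L 3 H₂).toLocal v) c')
    (ha : ConjClasses.map (UnitaryGroup.archPart (↥(maximalRealSubfield L)) L (IsCMField.complexConj L) 3 H₂) c =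
      ConjClasses.map (UnitaryGroup.archPart (↥(maximalRealSubfield L)) L (IsCMField.complexConj L) 3 H₂) c') :
    c = c' := by
  obtain ⟨p, rfl⟩ := hc
  obtain ⟨p', rfl⟩ := hc'
  dsimp only at hv ha ⊢
  rw [ConjClasses.mk_eq_mk_iff_isConj]
  have ha' : IsConj (UnitaryGroup.archPart (↥(maximalRealSubfield L)) L (IsCMField.complexConj L) 3 H₂ p.adele)
      (UnitaryGroup.archPart (↥(maximalRealSubfield L)) L (IsCMField.complexConj L) 3 H₂ p'.adele) :=
    ConjClasses.mk_eq_mk_iff_isConj.1 ha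
  have hv' : ∀ v : HeightOneSpectrum (𝓞 ↥(maximalRealSubfield L)),
      IsConj ((UnitaryGroup.cmDatum L 3 H₂).toLocal v p.adele) ((UnitaryGroup.cmDatum L 3 H₂).toLocal v p'.adele) :=
    fun v => ConjClasses.mk_eq_mk_iff_isConj.1 (hv v)
  have hK : ∀ᶠ v in cofinite, ∃ k : (UnitaryGroup.cmDatum L 3 H₂).Local v, k ∈ UnitaryGroup.cmLocalIntegralLevel L 3 H₂ v ∧
      k * (UnitaryGroup.cmDatum L 3 H₂).toLocal v p.adele * k⁻¹ = (UnitaryGroup.cmDatum L 3 H₂).toLocal v p'.adele := by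
    filter_upwards [MatchingAdeleG₂.eventually_forall_exists_conj hH₂ hdet hreg, eventually_toLocal_mem_cmLocalIntegralLevel p.adele,
      eventually_toLocal_mem_cmLocalIntegralLevel p'.adele] with v hKv hint hint'
    obtain ⟨k, hk, hkp⟩ := hKv _ _ hint hint' (p.corresponds_toLocal v) (p'.corresponds_toLocal v)
    exact ⟨k, hk, hkp⟩
  exact UnitaryGroup.isConj_of_isConj_archPart_of_forall_exists_conj (↥(maximalRealSubfield L)) L (IsCMField.complexConj L) 3 H₂ ha' hv' hK

/-! ## §4 (surj) every admissible family of local classes and archimedean class is read by a class of `𝒞_𝐀(γ₀)` -/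

/-- **(surj)**: let `γ₀ ↔ γ` (`γ ∈ U(H₂)(L⁺)` rational).  Every family `δ` of local classes with `(γ₀)_v ↔ out (δ v)` at every `v` and `δ v = [γ_v]` for almost all `v`,
together with every archimedean class `b` with `γ₀ ⊗ 1 ↔ out b`, is the family of local ∕ archimedean classes of some `c ∈ 𝒞_𝐀(γ₀)` — glue the representatives (`γ_v` on
the base classes, integral a.e.) by ★ `UnitaryGroup.exists_adelic_of_eventually_mem`. [cite: Rogawski1990, §3.3 p. 21; §5.4 p. 72] [cite: BorelJacquet1979, §4.1] -/
theorem MatchingAdeleG₂.exists_mem_classes_of_forall {γ : (UnitaryGroup.cmDatum L 3 H₂).Rational} (hγ : Corresponds (cmConjRingHom L) H₁ H₂ γ₀ γ)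
    (δ : ∀ v : HeightOneSpectrum (𝓞 ↥(maximalRealSubfield L)), ConjClasses ((UnitaryGroup.cmDatum L 3 H₂).Local v))
    (b : ConjClasses (UnitaryGroup.arch (↥(maximalRealSubfield L)) L (IsCMField.complexConj L) 3 H₂))
    (hδ : ∀ v, Corresponds (UnitaryGroup.conjLocal L (IsCMField.complexConj L) v)
      ((UnitaryGroup.adelicForm L 3 H₁).map (UnitaryGroup.adeleToLocal L v)) ((UnitaryGroup.adelicForm L 3 H₂).map (UnitaryGroup.adeleToLocal L v))
      ((UnitaryGroup.cmDatum L 3 H₁).toLocal v ((UnitaryGroup.cmDatum L 3 H₁).toAdelic γ₀)) (Quotient.out (δ v)))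
    (hev : ∀ᶠ v in cofinite, δ v = ConjClasses.mk ((UnitaryGroup.cmDatum L 3 H₂).toLocal v ((UnitaryGroup.cmDatum L 3 H₂).toAdelic γ)))
    (hb : Corresponds (UnitaryGroup.conjMixed (↥(maximalRealSubfield L)) L (IsCMField.complexConj L)) (UnitaryGroup.archFormOf L 3 H₁)
      (UnitaryGroup.archFormOf L 3 H₂) (cmRationalToArch L 3 H₁ γ₀) (Quotient.out b)) :
    ∃ c ∈ MatchingAdeleG₂.classes L H₁ H₂ γ₀,
      (∀ v, ConjClasses.map ((UnitaryGroup.cmDatum L 3 H₂).toLocal v) c = δ v) ∧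
      ConjClasses.map (UnitaryGroup.archPart (↥(maximalRealSubfield L)) L (IsCMField.complexConj L) 3 H₂) c = b := by
  classical
  let γv : ∀ v : HeightOneSpectrum (𝓞 ↥(maximalRealSubfield L)), (UnitaryGroup.cmDatum L 3 H₂).Local v := fun v =>
    (UnitaryGroup.cmDatum L 3 H₂).toLocal v ((UnitaryGroup.cmDatum L 3 H₂).toAdelic γ)
  let y : ∀ v : HeightOneSpectrum (𝓞 ↥(maximalRealSubfield L)), (UnitaryGroup.cmDatum L 3 H₂).Local v := fun v =>
    if δ v = ConjClasses.mk (γv v) then γv v else Quotient.out (δ v)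
  have hy_mk : ∀ v, ConjClasses.mk (y v) = δ v := by
    intro v
    by_cases h : δ v = ConjClasses.mk (γv v)
    · rw [show y v = γv v from if_pos h, h]
    · rw [show y v = Quotient.out (δ v) from if_neg h]
      exact conjClasses_mk_out_eq _
  have hy_int : ∀ᶠ v in cofinite, y v ∈ UnitaryGroup.localIntegralLevel (IsCMField.complexConj L) 3 H₂ v := by
    filter_upwards [hev, eventually_toLocal_mem_cmLocalIntegralLevel ((UnitaryGroup.cmDatum L 3 H₂).toAdelic γ)] with v hv hint
    have : y v = γv v := if_pos hv
    rw [this]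
    exact hint
  obtain ⟨x, hxa, hxv⟩ := UnitaryGroup.exists_adelic_of_eventually_mem (↥(maximalRealSubfield L)) L (IsCMField.complexConj L) 3 H₂
    (Quotient.out b) y hy_int
  have hxv' : ∀ v, (UnitaryGroup.cmDatum L 3 H₂).toLocal v x = y v := fun v => hxv v
  have hxcorr : ∀ v, Corresponds (UnitaryGroup.conjLocal L (IsCMField.complexConj L) v)
      ((UnitaryGroup.adelicForm L 3 H₁).map (UnitaryGroup.adeleToLocal L v)) ((UnitaryGroup.adelicForm L 3 H₂).map (UnitaryGroup.adeleToLocal L v))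
      ((UnitaryGroup.cmDatum L 3 H₁).toLocal v ((UnitaryGroup.cmDatum L 3 H₁).toAdelic γ₀)) ((UnitaryGroup.cmDatum L 3 H₂).toLocal v x) := by
    intro v
    rw [hxv' v]
    by_cases h : δ v = ConjClasses.mk (γv v)
    · have : y v = γv v := if_pos h
      rw [this]
      exact corresponds_toLocal_toAdelic hγ v
    · have : y v = Quotient.out (δ v) := if_neg h
      rw [this]
      exact hδ v
  let p : MatchingAdeleG₂ L H₁ H₂ γ₀ := ⟨x, hxcorr, by
    show Corresponds _ _ _ (cmRationalToArch L 3 H₁ γ₀) (UnitaryGroup.archPart (↥(maximalRealSubfield L)) L (IsCMField.complexConj L) 3 H₂ x)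
    rw [hxa]
    exact hb⟩
  refine ⟨ConjClasses.mk p.adele, ⟨p, rfl⟩, fun v => ?_, ?_⟩
  · rw [conjClasses_map_mk]
    exact (congrArg ConjClasses.mk (hxv' v)).trans (hy_mk v)
  · exact (congrArg ConjClasses.mk hxa).trans (conjClasses_mk_out_eq b)

end DictionaryG2

end Literature.NumberTheory.Rogawski1990

end
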